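import Summits.AtomisticToContinuum.BoseEinsteinCondensation.Theorems.BECCutLineWeakDisorderWitnessTransferCoreEntry
import Mathlib.MeasureTheory.Function.JacobianOneDim
import HarnessLib

/-!
# Route BECCutLineWeakDisorder — crux `WitnessTransfer`, line `Sketch`, stub (S6): pair geometry

Deterministic ingredients of (S6) (`stub_pairAction_ae_top_of_ne_zero`): the pair difference of
two world-lines, its decomposition into the radial component along `e = y/|y|` and the
transverse part, `|y + √2 d|² = (|y| + √2⟨e,d⟩)² + 2|d − ⟨e,d⟩e|²`, and the fibre integrals of
the windowed one-dimensional integrand `k_Q(u) = 𝟙{|u| ≤ 2√t} hₙ(√((r₀+2u)² + Q))`,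
`hₙ = min(v, n) 𝟙_{(r₀−√t, r₀+√t)}`: for a transverse budget `0 ≤ Q ≤ r₀√t/2` (`√t ≤ r₀/8`),
`M/2 ≤ ∫ k_Q ≤ M` with `M = ∫_{(r₀−√t, r₀+√t)} min(v, n)` (change of variables
`u = (√(r² − Q) − r₀)/2`, Jacobian in `[1/2, 1]`).
-/

noncomputable section

open MeasureTheory Filter Set Metric
open scoped ENNReal NNReal Topology

namespace Summit.AtomisticToContinuum.BoseEinsteinCondensation.Theorems.CutLineWitness

open Literature.MathematicalPhysics.QuantumManyBody.BoseGas
open Literature.Probability.Process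

/-! ### The pair difference of two world-lines -/

/-- `Bⁱ_s − Bʲ_s = (xᵢ − xⱼ) + √2 · (b_s(ω i l) − b_s(ω j l))_l`. [folklore] -/
theorem worldLine_sub_worldLine {N : ℕ} (X : Config N) (ω : PathSpace N) (s : ℝ≥0) (i j : Fin N) :
    worldLine X ω s i - worldLine X ω s j =
      (X i - X j) + WithLp.toLp 2 (fun l => Real.sqrt 2 * (brownian s (ω i l) - brownian s (ω j l))) := by
  unfold worldLine
  ext l
  simp only [PiLp.sub_apply, PiLp.add_apply]
  ring

/-- The pair distance is the norm of the pair difference. [folklore] -/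
theorem dist_worldLine_eq_norm {N : ℕ} (X : Config N) (ω : PathSpace N) (s : ℝ≥0) (i j : Fin N) :
    dist (worldLine X ω s i) (worldLine X ω s j) =
      ‖(X i - X j) + WithLp.toLp 2 (fun l => Real.sqrt 2 * (brownian s (ω i l) - brownian s (ω j l)))‖ := by
  rw [dist_eq_norm, worldLine_sub_worldLine]

/-! ### Radial / transverse decomposition of `|y + √2 d|` -/

/-- **Pythagoras along `e = y/|y|`.** For `y ≠ 0`, `e = |y|⁻¹ y` and `d ∈ ℝ³`, with
`U' = ∑ e_l d_l` and `q = ∑ (d_l − U' e_l)²`: `|y + √2 d|² = (|y| + √2 U')² + 2 q`. [folklore] -/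
theorem norm_add_sqrt_two_sq {y : Space} (hy : y ≠ 0) (d : Fin 3 → ℝ) :
    ‖y + WithLp.toLp 2 (fun l => Real.sqrt 2 * d l)‖ ^ 2 =
      (‖y‖ + Real.sqrt 2 * ∑ l, (‖y‖⁻¹ * y l) * d l) ^ 2 +
        2 * ∑ l, (d l - (∑ l', (‖y‖⁻¹ * y l') * d l') * (‖y‖⁻¹ * y l)) ^ 2 := by
  have hn : 0 < ‖y‖ := norm_pos_iff.2 hy
  have hs : Real.sqrt 2 ^ 2 = 2 := Real.sq_sqrt (by norm_num)
  have hy2 : ∑ l, y l ^ 2 = ‖y‖ ^ 2 := by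
    rw [EuclideanSpace.real_norm_sq_eq]
  rw [EuclideanSpace.real_norm_sq_eq]
  simp only [PiLp.add_apply]
  set U := ∑ l, (‖y‖⁻¹ * y l) * d l with hU
  have hUy : ∑ l, y l * d l = ‖y‖ * U := by
    rw [hU, Finset.mul_sum]
    refine Finset.sum_congr rfl fun l _ => ?_
    field_simp
  -- expand both sides in terms of ∑ y², ∑ y d, ∑ d²
  have lhs : ∑ l, (y l + Real.sqrt 2 * d l) ^ 2 =
      ∑ l, y l ^ 2 + 2 * Real.sqrt 2 * ∑ l, y l * d l + 2 * ∑ l, d l ^ 2 := by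
    have : ∀ l, (y l + Real.sqrt 2 * d l) ^ 2 =
        y l ^ 2 + 2 * Real.sqrt 2 * (y l * d l) + 2 * d l ^ 2 := by
      intro l; nlinarith [hs]
    simp only [this, Finset.sum_add_distrib, ← Finset.mul_sum]
  have rhs2 : ∑ l, (d l - U * (‖y‖⁻¹ * y l)) ^ 2 = ∑ l, d l ^ 2 - U ^ 2 := by
    have : ∀ l, (d l - U * (‖y‖⁻¹ * y l)) ^ 2 =
        d l ^ 2 - 2 * U * ‖y‖⁻¹ * (y l * d l) + U ^ 2 * ‖y‖⁻¹ ^ 2 * y l ^ 2 := by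
      intro l; ring
    simp only [this, Finset.sum_add_distrib, Finset.sum_sub_distrib, ← Finset.mul_sum, hUy, hy2]
    field_simp
    ring
  rw [lhs, rhs2, hy2, hUy]
  nlinarith [hs]

/-- The pair distance as a function of the radial component and the transverse square:
`|y + √2 d| = √((|y| + √2 U')² + 2q)`. [folklore] -/
theorem norm_add_sqrt_two_eq_sqrt {y : Space} (hy : y ≠ 0) (d : Fin 3 → ℝ) :
    ‖y + WithLp.toLp 2 (fun l => Real.sqrt 2 * d l)‖ =
      Real.sqrt ((‖y‖ + Real.sqrt 2 * ∑ l, (‖y‖⁻¹ * y l) * d l) ^ 2 +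
        2 * ∑ l, (d l - (∑ l', (‖y‖⁻¹ * y l') * d l') * (‖y‖⁻¹ * y l)) ^ 2) := by
  rw [← norm_add_sqrt_two_sq hy d, Real.sqrt_sq (norm_nonneg _)]

/-! ### Fibre integrals of the windowed one-dimensional integrand -/

/-- The substitution `ψ_Q(r) = (√(r² − Q) − r₀)/2` inverts `u ↦ √((r₀ + 2u)² + Q)` on
`r₀ + 2u ≥ 0`. [folklore] -/
theorem sqrt_sq_add_of_sub {r₀ Q r : ℝ} (hQr : Q ≤ r ^ 2) (hr : 0 ≤ r) :
    Real.sqrt ((r₀ + 2 * ((Real.sqrt (r ^ 2 - Q) - r₀) / 2)) ^ 2 + Q) = r := by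
  have h1 : r₀ + 2 * ((Real.sqrt (r ^ 2 - Q) - r₀) / 2) = Real.sqrt (r ^ 2 - Q) := by ring
  rw [h1, Real.sq_sqrt (by linarith), sub_add_cancel, Real.sqrt_sq hr]

/-- **Fibre integral of the windowed integrand (two-sided).** Let `0 < t`, `0 < r₀`,
`√t ≤ r₀/8`, `0 ≤ Q ≤ r₀√t/2`, and `M = ∫_{(r₀−√t, r₀+√t)} min(v, n)`. Then the integrand
`k_Q(u) = 𝟙{|u| ≤ 2√t} · (min(v, n) 𝟙_{(r₀−√t,r₀+√t)})(√((r₀+2u)²+Q))` has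
`M/2 ≤ ∫ k_Q ≤ M`. [folklore] -/
theorem lintegral_window_fibre (v : ℝ → ℝ≥0∞) (n : ℕ) {t r₀ Q : ℝ}
    (ht : 0 < t) (hr₀ : 0 < r₀) (htr : Real.sqrt t ≤ r₀ / 8) (hQ : 0 ≤ Q)
    (hQb : Q ≤ r₀ * Real.sqrt t / 2) :
    (∫⁻ r in Ioo (r₀ - Real.sqrt t) (r₀ + Real.sqrt t), min (v r) n) / 2 ≤
      ∫⁻ u, indicator {u : ℝ | |u| ≤ 2 * Real.sqrt t} (fun u =>
        indicator (Ioo (r₀ - Real.sqrt t) (r₀ + Real.sqrt t)) (fun r => min (v r) (n : ℝ≥0∞))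
          (Real.sqrt ((r₀ + 2 * u) ^ 2 + Q))) u ∧
    ∫⁻ u, indicator {u : ℝ | |u| ≤ 2 * Real.sqrt t} (fun u =>
        indicator (Ioo (r₀ - Real.sqrt t) (r₀ + Real.sqrt t)) (fun r => min (v r) (n : ℝ≥0∞))
          (Real.sqrt ((r₀ + 2 * u) ^ 2 + Q))) u ≤
      ∫⁻ r in Ioo (r₀ - Real.sqrt t) (r₀ + Real.sqrt t), min (v r) n := by
  set st := Real.sqrt t with hst
  have hst0 : 0 < st := Real.sqrt_pos.2 ht
  set W : Set ℝ := Ioo (r₀ - st) (r₀ + st) with hW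
  set h : ℝ → ℝ≥0∞ := indicator W fun r => min (v r) (n : ℝ≥0∞) with hh
  set G : ℝ → ℝ≥0∞ := indicator {u : ℝ | |u| ≤ 2 * st} fun u => h (Real.sqrt ((r₀ + 2 * u) ^ 2 + Q))
    with hG
  set ψ : ℝ → ℝ := fun r => (Real.sqrt (r ^ 2 - Q) - r₀) / 2 with hψ
  set ψ' : ℝ → ℝ := fun r => r / (2 * Real.sqrt (r ^ 2 - Q)) with hψ'
  -- basic inequalities on the window
  have hWpos : ∀ r ∈ W, r₀ / 2 < r := fun r hr => by
    have := hr.1; linarith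
  have hQr : ∀ r ∈ W, Q < r ^ 2 := fun r hr => by
    have h1 := hWpos r hr
    have h2 : r₀ * st / 2 ≤ r₀ ^ 2 / 16 := by nlinarith
    nlinarith
  have hQr' : ∀ r ∈ W, Q ≤ 3 * r ^ 2 / 4 := fun r hr => by
    have h1 := hWpos r hr
    nlinarith
  -- derivative and injectivity of ψ on W
  have hderiv : ∀ r ∈ W, HasDerivWithinAt ψ (ψ' r) W r := by
    intro r hr
    have hpos : 0 < r ^ 2 - Q := by linarith [hQr r hr]
    have h1 : HasDerivAt (fun r : ℝ => r ^ 2 - Q) (2 * r) r := by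
      simpa using (hasDerivAt_pow 2 r).sub_const Q
    have h2 := h1.sqrt hpos.ne'
    have h3 := (h2.sub_const r₀).div_const 2
    refine (h3.congr_deriv ?_).hasDerivWithinAt
    rw [hψ']
    field_simp
  have hinj : InjOn ψ W := by
    intro a ha b hb hab
    have ha0 : 0 < a := by linarith [hWpos a ha]
    have hb0 : 0 < b := by linarith [hWpos b hb]
    have h1 : Real.sqrt (a ^ 2 - Q) = Real.sqrt (b ^ 2 - Q) := by
      simp only [hψ] at hab; linarith
    have h2 : a ^ 2 - Q = b ^ 2 - Q := by
      have := congrArg (· ^ 2) h1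
      simpa [Real.sq_sqrt (by linarith [hQr a ha] : (0:ℝ) ≤ a ^ 2 - Q),
        Real.sq_sqrt (by linarith [hQr b hb] : (0:ℝ) ≤ b ^ 2 - Q)] using this
    nlinarith
  -- change of variables
  have hcv := lintegral_image_eq_lintegral_abs_deriv_mul measurableSet_Ioo hderiv hinj G
  -- G vanishes off ψ '' W
  have hsupp : ∀ u, G u ≠ 0 → u ∈ ψ '' W := by
    intro u hu
    have hu1 : u ∈ {u : ℝ | |u| ≤ 2 * st} := by
      by_contra hc; exact hu (by rw [hG, indicator_of_notMem hc])
    have hu2 : Real.sqrt ((r₀ + 2 * u) ^ 2 + Q) ∈ W := by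
      by_contra hc
      exact hu (by rw [hG, indicator_of_mem hu1, hh, indicator_of_notMem hc])
    refine ⟨Real.sqrt ((r₀ + 2 * u) ^ 2 + Q), hu2, ?_⟩
    have hu1' : |u| ≤ 2 * st := hu1
    have hpos : 0 ≤ r₀ + 2 * u := by
      have := abs_le.1 hu1'; nlinarith
    simp only [hψ]
    rw [Real.sq_sqrt (by positivity), add_sub_cancel_right, Real.sqrt_sq hpos]
    ring
  have hGeq : ∫⁻ u, G u = ∫⁻ u in ψ '' W, G u :=
    (setLIntegral_eq_of_support_subset fun u hu => hsupp u hu).symm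
  -- the integrand after substitution
  have hst8 : 4 * st < r₀ := by linarith
  have hGψ : ∀ r ∈ W, G (ψ r) = min (v r) (n : ℝ≥0∞) := by
    intro r hr
    have hr0 : 0 ≤ r := by linarith [hWpos r hr]
    have hsq : Real.sqrt ((r₀ + 2 * ψ r) ^ 2 + Q) = r := sqrt_sq_add_of_sub (hQr r hr).le hr0
    have hψle : |ψ r| ≤ 2 * st := by
      rw [abs_le]
      have h1 : Real.sqrt (r ^ 2 - Q) ≤ r := by
        rw [Real.sqrt_le_left hr0]; linarith
      have h2 : r₀ - 4 * st ≤ Real.sqrt (r ^ 2 - Q) := by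
        apply Real.le_sqrt_of_sq_le
        have h3 : (r₀ - st) ^ 2 ≤ r ^ 2 := by
          have := hr.1; nlinarith
        nlinarith [hr.1, hr.2]
      simp only [hψ]
      constructor <;> linarith [hr.2]
    rw [hG, indicator_of_mem (show ψ r ∈ {u : ℝ | |u| ≤ 2 * st} from hψle), hsq, hh,
      indicator_of_mem hr]
  have hψ'b : ∀ r ∈ W, 1 / 2 ≤ ψ' r ∧ ψ' r ≤ 1 := by
    intro r hr
    have hr0 : 0 < r := by linarith [hWpos r hr]
    have hpos : 0 < r ^ 2 - Q := by linarith [hQr r hr]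
    have hs0 : 0 < Real.sqrt (r ^ 2 - Q) := Real.sqrt_pos.2 hpos
    have hs1 : Real.sqrt (r ^ 2 - Q) ≤ r := by
      rw [Real.sqrt_le_left hr0.le]; linarith
    have hs2 : r ≤ 2 * Real.sqrt (r ^ 2 - Q) := by
      have h4 : r ^ 2 ≤ 4 * (r ^ 2 - Q) := by linarith [hQr' r hr]
      have h5 : r ^ 2 ≤ (2 * Real.sqrt (r ^ 2 - Q)) ^ 2 := by
        rw [mul_pow, Real.sq_sqrt hpos.le]; linarith
      nlinarith [h5, hs0, hr0]
    simp only [hψ']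
    constructor
    · rw [div_le_div_iff₀ (by norm_num) (by positivity)]; linarith
    · rw [div_le_one (by positivity)]; exact hs2
  have hmid : ∫⁻ u, G u = ∫⁻ r in W, ENNReal.ofReal (ψ' r) * min (v r) (n : ℝ≥0∞) := by
    rw [hGeq, hcv]
    refine setLIntegral_congr_fun measurableSet_Ioo fun r hr => ?_
    rw [hGψ r hr, abs_of_pos (by linarith [(hψ'b r hr).1])]
  refine ⟨?_, ?_⟩
  · rw [hmid, ENNReal.div_eq_inv_mul, ← lintegral_const_mul' _ _ (by simp)]
    refine setLIntegral_mono' measurableSet_Ioo fun r hr => ?_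
    gcongr
    rw [show (2 : ℝ≥0∞)⁻¹ = ENNReal.ofReal (1 / 2) by
      rw [one_div, ENNReal.ofReal_inv_of_pos (by norm_num), ENNReal.ofReal_ofNat]]
    exact ENNReal.ofReal_le_ofReal (hψ'b r hr).1
  · rw [hmid]
    refine setLIntegral_mono' measurableSet_Ioo fun r hr => ?_
    calc ENNReal.ofReal (ψ' r) * min (v r) (n : ℝ≥0∞)
        ≤ 1 * min (v r) (n : ℝ≥0∞) := by
          gcongr
          rw [← ENNReal.ofReal_one]
          exact ENNReal.ofReal_le_ofReal (hψ'b r hr).2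
      _ = min (v r) (n : ℝ≥0∞) := one_mul _

end Summit.AtomisticToContinuum.BoseEinsteinCondensation.Theorems.CutLineWitness

end
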